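import Mathlib.Analysis.MellinTransform
import Mathlib.Analysis.SpecialFunctions.ImproperIntegrals
import Mathlib.Analysis.Calculus.IteratedDeriv.Lemmas
import Mathlib.Analysis.Calculus.ContDiff.Bounds
import Mathlib.Analysis.SpecialFunctions.JapaneseBracket
import Mathlib.MeasureTheory.Function.JacobianOneDim
import Literature.Analysis.Distribution.LogWeightSchwartz
import HarnessLib

/-!
# Meyer's global difference representation — proofs, `K = ℚ`: the logarithmic primitive `R_s`

Topic `NumberTheory/Automorphic`; namespace `Literature.NumberTheory.Automorphic.Meyer`. Sibling
PROOF file (real analysis on `ℝ`, Mathlib only) for Step D of the plan for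
`Meyer.spectralRealisation_rat` [Meyer2005, Thm. 5.11].

In the logarithmic coordinate `y = log |x|` an `𝒪̂ˣ`-invariant element of Meyer's space
`H₋ = 𝒮(C_ℚ)_∪ = ⋂_α 𝒮(C_ℚ)_α` [Meyer2005, §4.1, §5.3] is a smooth function `φ` on `ℝ` all of whose
derivatives decay faster than every exponential at both ends (`MeyerRatLogCoordinate`,
`mem_Hminus_iff_of_unramified`). We call such functions **super-exponentially decaying**
(`IsSuperExp`). Their two-sided Laplace transform `𝓛φ(z) = ∫ φ(y) e^{zy} dy` (`laplace`) — which is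
the Mellin transform `∫₀^∞ φ(log t) t^{z-1} dt` (`mellin_comp_log`), i.e. Meyer's Fourier–Laplace
transform `f̂(|x|^z)` [Meyer2005, §2.3] — is entire, and `𝓛(φ') = -z 𝓛φ`.

The main construction is the **logarithmic primitive**

  `R_s φ (y) = -e^{-sy} ∫_{-∞}^{y} e^{sτ} φ(τ) dτ`     (`logPrimitive s φ`),

the unique super-exponentially decaying solution of `-ψ' - sψ = φ` when `𝓛φ(s) = 0`:
* `hasDerivAt_logPrimitive` — `(R_s φ)' = -s R_s φ - φ`;
* **`isSuperExp_logPrimitive`** — if `𝓛φ(s) = 0` then `R_s φ` is again super-exponentially decaying;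
* **`laplace_logPrimitive`** — `(z - s) 𝓛(R_s φ)(z) = 𝓛φ(z)`: `R_s` divides the Fourier–Laplace
  transform by `z - s`. Iterating `R_s` at a zero of `f̂` of order `m` produces the Jordan chains of
  length `m` for the character `|x|^s` in `π₋` [Meyer2005, Thm. 5.11 and §2.3, proof of the spectral
  multiplicity statement via `(z - s)^{-j}`-division of the Fourier–Laplace transform].

The decay clause of `IsSuperExp` is the tree's `Literature.Analysis.Distribution.SuperExpDecay`
(`LogWeightSchwartz`) up to the polynomial weight, which is absorbed by `e^{β|y|}`:
`isSuperExp_iff_superExpDecay : IsSuperExp φ ↔ ContDiff ℝ ∞ φ ∧ SuperExpDecay φ`.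

Everything is proved; the definitions are the predicate `IsSuperExp` and the two operators.

## References

* R. Meyer, *On a representation of the idele class group related to primes and zeros of
  L-functions*, Duke Math. J. 127 (2005) = arXiv:math/0311468, §2.3, §4.1, Thm. 5.11 [Meyer2005].
-/

noncomputable section

open MeasureTheory Set Filter Complex
open scoped Topology ContDiff

namespace Literature.NumberTheory.Automorphic.Meyer

/-! ### Super-exponentially decaying smooth functions -/

/-- **Super-exponentially decaying smooth functions on `ℝ`**: `φ` is smooth and for all `n, β ∈ ℕ`
and every real `α`, `(1+|y|)^β |φ⁽ⁿ⁾(y)| e^{αy}` is bounded. This is Meyer's `𝒮(C_ℚ)_ℝ = ⋂_α 𝒮(C_ℚ)_α`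
for `𝒪̂ˣ`-invariant functions, read in the coordinate `y = log |x|` [Meyer2005, §4.1 and Lemma 5.10].
[cite: Meyer2005, §4.1] -/
structure IsSuperExp (φ : ℝ → ℂ) : Prop where
  contDiff : ContDiff ℝ ∞ φ
  decay : ∀ (n β : ℕ) (α : ℝ), ∃ C : ℝ, ∀ y : ℝ,
    (1 + |y|) ^ β * (‖iteratedDeriv n φ y‖ * Real.exp (α * y)) ≤ C

namespace IsSuperExp

variable {φ ψ : ℝ → ℂ}

/-- The zero function. [folklore] -/
theorem zero : IsSuperExp (0 : ℝ → ℂ) := by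
  refine ⟨contDiff_const, fun n β α => ⟨0, fun y => ?_⟩⟩
  have : iteratedDeriv n (0 : ℝ → ℂ) y = 0 := by
    rw [show (0 : ℝ → ℂ) = fun _ => (0 : ℂ) from rfl, iteratedDeriv_const]
    simp
  rw [this, norm_zero, zero_mul, mul_zero]

/-- Sums. [folklore] -/
theorem add (hφ : IsSuperExp φ) (hψ : IsSuperExp ψ) : IsSuperExp (φ + ψ) := by
  refine ⟨hφ.contDiff.add hψ.contDiff, fun n β α => ?_⟩
  obtain ⟨C₁, h₁⟩ := hφ.decay n β α
  obtain ⟨C₂, h₂⟩ := hψ.decay n β α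
  refine ⟨C₁ + C₂, fun y => ?_⟩
  rw [iteratedDeriv_add (hφ.contDiff.of_le (mod_cast le_top)).contDiffAt
    (hψ.contDiff.of_le (mod_cast le_top)).contDiffAt]
  have hw : 0 ≤ (1 + |y|) ^ β := by positivity
  have he : 0 ≤ Real.exp (α * y) := (Real.exp_pos _).le
  calc (1 + |y|) ^ β * (‖iteratedDeriv n φ y + iteratedDeriv n ψ y‖ * Real.exp (α * y))
      ≤ (1 + |y|) ^ β * ((‖iteratedDeriv n φ y‖ + ‖iteratedDeriv n ψ y‖) * Real.exp (α * y)) := by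
        gcongr; exact norm_add_le _ _
    _ = (1 + |y|) ^ β * (‖iteratedDeriv n φ y‖ * Real.exp (α * y)) +
          (1 + |y|) ^ β * (‖iteratedDeriv n ψ y‖ * Real.exp (α * y)) := by ring
    _ ≤ C₁ + C₂ := add_le_add (h₁ y) (h₂ y)

/-- Scalar multiples. [folklore] -/
theorem const_mul (hφ : IsSuperExp φ) (c : ℂ) : IsSuperExp (fun y => c * φ y) := by
  refine ⟨contDiff_const.mul hφ.contDiff, fun n β α => ?_⟩
  obtain ⟨C, hC⟩ := hφ.decay n β α
  refine ⟨‖c‖ * C, fun y => ?_⟩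
  have h := iteratedDeriv_const_mul c (n := n) (x := y) ((hφ.contDiff.of_le (mod_cast le_top)).contDiffAt)
  rw [h, norm_mul]
  have hw : 0 ≤ (1 + |y|) ^ β := by positivity
  calc (1 + |y|) ^ β * (‖c‖ * ‖iteratedDeriv n φ y‖ * Real.exp (α * y))
      = ‖c‖ * ((1 + |y|) ^ β * (‖iteratedDeriv n φ y‖ * Real.exp (α * y))) := by ring
    _ ≤ ‖c‖ * C := by gcongr; exact hC y

/-- Negatives. [folklore] -/
theorem neg (hφ : IsSuperExp φ) : IsSuperExp (-φ) := by
  have h := hφ.const_mul (-1)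
  have : (fun y => (-1 : ℂ) * φ y) = -φ := by funext y; simp
  rwa [this] at h

/-- Differences. [folklore] -/
theorem sub (hφ : IsSuperExp φ) (hψ : IsSuperExp ψ) : IsSuperExp (φ - ψ) := by
  rw [sub_eq_add_neg]; exact hφ.add hψ.neg

/-- Derivatives. [folklore] -/
theorem deriv (hφ : IsSuperExp φ) : IsSuperExp (deriv φ) := by
  refine ⟨(contDiff_infty_iff_deriv.mp hφ.contDiff).2, fun n β α => ?_⟩
  obtain ⟨C, hC⟩ := hφ.decay (n + 1) β α
  exact ⟨C, fun y => by rw [← iteratedDeriv_succ']; exact hC y⟩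

/-- The basic pointwise bound: `‖φ(y)‖ e^{αy} ≤ C_α`. [folklore] -/
theorem norm_mul_exp_le (hφ : IsSuperExp φ) (α : ℝ) : ∃ C : ℝ, ∀ y : ℝ, ‖φ y‖ * Real.exp (α * y) ≤ C := by
  obtain ⟨C, hC⟩ := hφ.decay 0 0 α
  exact ⟨C, fun y => by simpa [iteratedDeriv_zero] using hC y⟩

/-- The weighted pointwise bound: `(1+|y|)^β ‖φ(y)‖ e^{αy} ≤ C`. [folklore] -/
theorem weight_norm_mul_exp_le (hφ : IsSuperExp φ) (β : ℕ) (α : ℝ) :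
    ∃ C : ℝ, ∀ y : ℝ, (1 + |y|) ^ β * (‖φ y‖ * Real.exp (α * y)) ≤ C := by
  obtain ⟨C, hC⟩ := hφ.decay 0 β α
  exact ⟨C, fun y => by simpa [iteratedDeriv_zero] using hC y⟩

/-- `φ` is continuous. [folklore] -/
theorem continuous (hφ : IsSuperExp φ) : Continuous φ := hφ.contDiff.continuous

/-- **Integrability against exponentials**: `y ↦ φ(y) e^{zy}` is integrable for every `z ∈ ℂ`.
[folklore] -/
theorem integrable_mul_cexp (hφ : IsSuperExp φ) (z : ℂ) :
    Integrable fun y : ℝ => φ y * cexp (z * y) := by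
  obtain ⟨C, hC⟩ := hφ.weight_norm_mul_exp_le 2 z.re
  have hcont : Continuous fun y : ℝ => φ y * cexp (z * y) := by
    have := hφ.continuous; fun_prop
  refine Integrable.mono' ((integrable_one_add_norm (E := ℝ) (r := 2)
    (by rw [Module.finrank_self]; norm_num)).const_mul C) hcont.aestronglyMeasurable
    (Eventually.of_forall fun y => ?_)
  have hw : 0 < (1 + |y|) ^ (2 : ℕ) := by positivity
  rw [norm_mul, Complex.norm_exp, Complex.mul_re, Complex.ofReal_re, Complex.ofReal_im, mul_zero,
    sub_zero, Real.norm_eq_abs, Real.rpow_neg (by positivity), ← div_eq_mul_inv,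
    le_div_iff₀ (by positivity), Real.rpow_two, mul_comm]
  exact hC y

end IsSuperExp

/-! ### The two-sided Laplace transform = the Mellin transform in the coordinate `t = e^y` -/

/-- The two-sided Laplace transform `𝓛φ(z) = ∫ φ(y) e^{zy} dy` — Meyer's Fourier–Laplace transform
`f̂(|x|^z) = ∫_{C_ℚ} f(x) |x|^z d^×x` of an unramified `f` with `φ(y) = f[z(e^y)]`. [cite: Meyer2005, §2.3] -/
def laplace (φ : ℝ → ℂ) (z : ℂ) : ℂ :=
  ∫ y : ℝ, φ y * cexp (z * y)

/-- `e^y · (e^y)^{z-1} = e^{zy}` for real `y`. [folklore] -/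
theorem ofReal_exp_mul_cpow (y : ℝ) (z : ℂ) :
    ((Real.exp y : ℝ) : ℂ) * ((Real.exp y : ℝ) : ℂ) ^ (z - 1) = cexp (z * y) := by
  rw [Complex.ofReal_exp, Complex.cpow_def_of_ne_zero (Complex.exp_ne_zero _),
    Complex.log_exp (by simp [Real.pi_pos]) (by simpa using Real.pi_pos.le), ← Complex.exp_add]
  congr 1
  ring

/-- **`𝓛φ(z)` is the Mellin transform of `t ↦ φ(log t)`** (substitution `t = e^y`). [folklore] -/
theorem mellin_comp_log (φ : ℝ → ℂ) (z : ℂ) :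
    mellin (fun t : ℝ => φ (Real.log t)) z = laplace φ z := by
  have himage : Real.exp '' univ = Ioi (0 : ℝ) := by rw [image_univ, Real.range_exp]
  have hderiv : ∀ x ∈ (univ : Set ℝ), HasDerivWithinAt Real.exp (Real.exp x) univ x :=
    fun x _ => (Real.hasDerivAt_exp x).hasDerivWithinAt
  rw [mellin, ← himage, integral_image_eq_integral_abs_deriv_smul MeasurableSet.univ hderiv
    Real.exp_injective.injOn, setIntegral_univ, laplace]
  refine integral_congr_ae (Eventually.of_forall fun y => ?_)
  simp only [Real.log_exp, smul_eq_mul]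
  rw [abs_of_pos (Real.exp_pos y), Complex.real_smul, ← mul_assoc, ofReal_exp_mul_cpow, mul_comm]

/-- The same substitution for Mellin convergence. [folklore] -/
theorem mellinConvergent_comp_log_iff (φ : ℝ → ℂ) (z : ℂ) :
    MellinConvergent (fun t : ℝ => φ (Real.log t)) z ↔ Integrable fun y : ℝ => φ y * cexp (z * y) := by
  have himage : Real.exp '' univ = Ioi (0 : ℝ) := by rw [image_univ, Real.range_exp]
  have hderiv : ∀ x ∈ (univ : Set ℝ), HasDerivWithinAt Real.exp (Real.exp x) univ x :=
    fun x _ => (Real.hasDerivAt_exp x).hasDerivWithinAt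
  rw [MellinConvergent, ← himage, integrableOn_image_iff_integrableOn_abs_deriv_smul MeasurableSet.univ
    hderiv Real.exp_injective.injOn, integrableOn_univ]
  have hfun : (fun x : ℝ => |Real.exp x| • ((Real.exp x : ℂ) ^ (z - 1) • φ (Real.log (Real.exp x)))) =
      fun y : ℝ => φ y * cexp (z * y) := by
    funext y
    simp only [Real.log_exp, smul_eq_mul]
    rw [abs_of_pos (Real.exp_pos y), Complex.real_smul, ← mul_assoc, ofReal_exp_mul_cpow, mul_comm]
  rw [hfun]

/-- **`𝓛(φ')(z) = -z 𝓛φ(z)`** for super-exponentially decaying `φ` (integration by parts on `ℝ`).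
[folklore] -/
theorem laplace_deriv {φ : ℝ → ℂ} (hφ : IsSuperExp φ) (z : ℂ) :
    laplace (deriv φ) z = -z * laplace φ z := by
  rw [laplace, laplace]
  have hu : ∀ y ∈ tsupport (fun y : ℝ => cexp (z * y)), HasDerivAt φ (deriv φ y) y :=
    fun y _ => ((hφ.contDiff.differentiable (by simp)).differentiableAt).hasDerivAt
  have hv : ∀ y ∈ tsupport φ, HasDerivAt (fun y : ℝ => cexp (z * y)) (z * cexp (z * y)) y := by
    intro y _
    have h : HasDerivAt (fun y : ℝ => cexp (z * y)) (cexp (z * y) * z) y := by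
      simpa using ((hasDerivAt_id (y : ℂ)).const_mul z).cexp.comp_ofReal
    exact h.congr_deriv (mul_comm _ _)
  have h1 : Integrable (φ * fun y : ℝ => z * cexp (z * y)) := by
    have := (hφ.integrable_mul_cexp z).const_mul z
    refine this.congr (Eventually.of_forall fun y => ?_)
    simp only [Pi.mul_apply]; ring
  have h2 : Integrable (deriv φ * fun y : ℝ => cexp (z * y)) := hφ.deriv.integrable_mul_cexp z
  have h3 : Integrable (φ * fun y : ℝ => cexp (z * y)) := hφ.integrable_mul_cexp z
  have h := integral_mul_deriv_eq_deriv_mul_of_integrable hu hv h1 h2 h3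
  -- `h : ∫ φ · (z e^{zy}) = -∫ φ' · e^{zy}`
  have h' : ∫ y : ℝ, φ y * (z * cexp (z * y)) = z * ∫ y : ℝ, φ y * cexp (z * y) := by
    rw [← integral_const_mul]
    refine integral_congr_ae (Eventually.of_forall fun y => ?_)
    ring
  rw [h'] at h
  linear_combination h

/-! ### The logarithmic primitive `R_s` -/

/-- **The logarithmic primitive** `R_s φ (y) = -e^{-sy} ∫_{-∞}^y e^{sτ} φ(τ) dτ`. [cite: Meyer2005, Thm. 5.11] -/
def logPrimitive (s : ℂ) (φ : ℝ → ℂ) (y : ℝ) : ℂ :=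
  -cexp (-(s * y)) * ∫ τ in Iic y, φ τ * cexp (s * τ)

section LogPrimitive

variable {φ : ℝ → ℂ} (s : ℂ)

/-- The partial Laplace integral `Φ(y) = ∫_{-∞}^y e^{sτ} φ(τ) dτ` has derivative `e^{sy} φ(y)`.
[folklore] -/
theorem hasDerivAt_integral_Iic (hφ : IsSuperExp φ) (y : ℝ) :
    HasDerivAt (fun u : ℝ => ∫ τ in Iic u, φ τ * cexp (s * τ)) (φ y * cexp (s * y)) y := by
  have hint := hφ.integrable_mul_cexp s
  have hcont : Continuous fun τ : ℝ => φ τ * cexp (s * τ) := by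
    have := hφ.continuous; fun_prop
  have heq : (fun u : ℝ => ∫ τ in Iic u, φ τ * cexp (s * τ)) =
      fun u : ℝ => (∫ τ in Iic 0, φ τ * cexp (s * τ)) + ∫ τ in (0 : ℝ)..u, φ τ * cexp (s * τ) := by
    funext u
    rw [← intervalIntegral.integral_Iic_sub_Iic hint.integrableOn hint.integrableOn]
    ring
  rw [heq]
  refine (intervalIntegral.integral_hasDerivAt_right (hcont.intervalIntegrable _ _)
    (hcont.stronglyMeasurableAtFilter _ _) hcont.continuousAt).const_add _

/-- **`(R_s φ)' = -s R_s φ - φ`.** [cite: Meyer2005, Thm. 5.11] -/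
theorem hasDerivAt_logPrimitive (hφ : IsSuperExp φ) (y : ℝ) :
    HasDerivAt (logPrimitive s φ) (-s * logPrimitive s φ y - φ y) y := by
  have h0 : HasDerivAt (fun u : ℝ => -(s * (u : ℂ))) (-(s * 1)) y :=
    ((hasDerivAt_id' (y : ℂ)).const_mul s).neg.comp_ofReal
  have h1 : HasDerivAt (fun u : ℝ => -cexp (-(s * u))) (s * cexp (-(s * y))) y :=
    h0.cexp.neg.congr_deriv (by ring)
  have h2 := hasDerivAt_integral_Iic s hφ y
  have h := h1.mul h2
  have heq : logPrimitive s φ =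
      (fun u : ℝ => -cexp (-(s * u))) * fun u : ℝ => ∫ τ in Iic u, φ τ * cexp (s * τ) := rfl
  rw [heq]
  refine h.congr_deriv ?_
  show s * cexp (-(s * y)) * (∫ τ in Iic y, φ τ * cexp (s * τ)) + -cexp (-(s * y)) * (φ y * cexp (s * y)) =
    -s * (-cexp (-(s * y)) * ∫ τ in Iic y, φ τ * cexp (s * τ)) - φ y
  have hexp : cexp (-(s * y)) * cexp (s * y) = 1 := by rw [← Complex.exp_add]; simp
  linear_combination (-(φ y)) * hexp

/-- `deriv (R_s φ) = -s R_s φ - φ`. [folklore] -/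
theorem deriv_logPrimitive (hφ : IsSuperExp φ) :
    _root_.deriv (logPrimitive s φ) = fun y => -s * logPrimitive s φ y - φ y :=
  funext fun y => (hasDerivAt_logPrimitive s hφ y).deriv

/-- `R_s φ` is differentiable. [folklore] -/
theorem differentiable_logPrimitive (hφ : IsSuperExp φ) : Differentiable ℝ (logPrimitive s φ) :=
  fun y => (hasDerivAt_logPrimitive s hφ y).differentiableAt

/-- **`R_s φ` is smooth.** [folklore] -/
theorem contDiff_logPrimitive (hφ : IsSuperExp φ) : ContDiff ℝ ∞ (logPrimitive s φ) := by
  -- the partial integral is smooth because its derivative `φ e^{s·}` is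
  have hsm : ContDiff ℝ ∞ fun τ : ℝ => φ τ * cexp (s * τ) := by
    have h1 : ContDiff ℝ ∞ fun τ : ℝ => cexp (s * τ) := by
      have : ContDiff ℝ ∞ fun τ : ℝ => (s * (τ : ℂ)) := contDiff_const.mul Complex.ofRealCLM.contDiff
      exact Complex.contDiff_exp.comp this
    exact hφ.contDiff.mul h1
  have hΦ : ContDiff ℝ ∞ fun u : ℝ => ∫ τ in Iic u, φ τ * cexp (s * τ) := by
    rw [contDiff_infty_iff_deriv]
    refine ⟨fun y => (hasDerivAt_integral_Iic s hφ y).differentiableAt, ?_⟩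
    have : _root_.deriv (fun u : ℝ => ∫ τ in Iic u, φ τ * cexp (s * τ)) = fun y => φ y * cexp (s * y) :=
      funext fun y => (hasDerivAt_integral_Iic s hφ y).deriv
    rw [this]
    exact hsm
  have hE : ContDiff ℝ ∞ fun u : ℝ => -cexp (-(s * u)) := by
    have : ContDiff ℝ ∞ fun τ : ℝ => (-(s * (τ : ℂ))) := (contDiff_const.mul Complex.ofRealCLM.contDiff).neg
    exact (Complex.contDiff_exp.comp this).neg
  exact hE.mul hΦ

/-- The other representation: if `𝓛φ(s) = 0` then `R_s φ (y) = e^{-sy} ∫_y^∞ e^{sτ} φ(τ) dτ`.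
[cite: Meyer2005, Thm. 5.11] -/
theorem logPrimitive_eq_integral_Ioi (hφ : IsSuperExp φ) (h0 : laplace φ s = 0) (y : ℝ) :
    logPrimitive s φ y = cexp (-(s * y)) * ∫ τ in Ioi y, φ τ * cexp (s * τ) := by
  have hint := hφ.integrable_mul_cexp s
  have hsplit : (∫ τ in Iic y, φ τ * cexp (s * τ)) + ∫ τ in Ioi y, φ τ * cexp (s * τ) = 0 := by
    rw [← setIntegral_union (Iic_disjoint_Ioi le_rfl) measurableSet_Ioi hint.integrableOn hint.integrableOn,
      Iic_union_Ioi, setIntegral_univ]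
    exact h0
  rw [logPrimitive, eq_neg_of_add_eq_zero_left hsplit]
  ring

/-- Integral of the exponential majorant over `(-∞, y]`. [folklore] -/
theorem integral_Iic_exp_mul_le {c : ℝ} (hc : 0 < c) (C : ℝ) (y : ℝ) :
    ∫ τ in Iic y, C * Real.exp (c * τ) = C * (Real.exp (c * y) / c) := by
  rw [integral_const_mul]
  congr 1
  have h := integral_exp_mul_complex_Iic (a := (c : ℂ)) (by simpa using hc) y
  have h2 : (∫ τ in Iic y, Real.exp (c * τ) : ℝ) = (∫ τ in Iic y, cexp ((c : ℂ) * τ)).re := by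
    rw [← RCLike.re_to_complex, ← integral_re (integrableOn_exp_mul_complex_Iic (by simpa using hc) y)]
    refine setIntegral_congr_fun measurableSet_Iic fun τ _ => ?_
    rw [RCLike.re_to_complex, ← Complex.ofReal_mul, Complex.exp_ofReal_re]
  rw [h2, h, ← Complex.ofReal_mul, ← Complex.ofReal_exp, ← Complex.ofReal_div, Complex.ofReal_re]

/-- Integral of the exponential majorant over `(y, ∞)`. [folklore] -/
theorem integral_Ioi_exp_mul_le {c : ℝ} (hc : c < 0) (C : ℝ) (y : ℝ) :
    ∫ τ in Ioi y, C * Real.exp (c * τ) = C * (-Real.exp (c * y) / c) := by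
  rw [integral_const_mul]
  congr 1
  have h := integral_exp_mul_complex_Ioi (a := (c : ℂ)) (by simpa using hc) y
  have h2 : (∫ τ in Ioi y, Real.exp (c * τ) : ℝ) = (∫ τ in Ioi y, cexp ((c : ℂ) * τ)).re := by
    rw [← RCLike.re_to_complex, ← integral_re (integrableOn_exp_mul_complex_Ioi (by simpa using hc) y)]
    refine setIntegral_congr_fun measurableSet_Ioi fun τ _ => ?_
    rw [RCLike.re_to_complex, ← Complex.ofReal_mul, Complex.exp_ofReal_re]
  rw [h2, h, ← Complex.ofReal_mul, ← Complex.ofReal_exp, ← Complex.ofReal_neg, ← Complex.ofReal_div,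
    Complex.ofReal_re]

/-- **Bound from below the abscissa**: for `a < Re s`, `‖R_s φ(y)‖ e^{ay} ≤ C_a / (Re s - a)`.
[cite: Meyer2005, Thm. 5.11] -/
theorem norm_logPrimitive_mul_exp_le_of_lt (hφ : IsSuperExp φ) {a : ℝ} (ha : a < s.re) :
    ∃ C : ℝ, ∀ y : ℝ, ‖logPrimitive s φ y‖ * Real.exp (a * y) ≤ C := by
  obtain ⟨C, hC⟩ := hφ.norm_mul_exp_le a
  have hC0 : 0 ≤ C := le_trans (by positivity) (hC 0)
  have hc : 0 < s.re - a := by linarith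
  refine ⟨C / (s.re - a), fun y => ?_⟩
  have hbound : ∀ τ : ℝ, ‖φ τ * cexp (s * τ)‖ ≤ C * Real.exp ((s.re - a) * τ) := by
    intro τ
    rw [norm_mul, Complex.norm_exp, Complex.mul_re, Complex.ofReal_re, Complex.ofReal_im, mul_zero,
      sub_zero]
    have h := hC τ
    have : Real.exp (s.re * τ) = Real.exp (a * τ) * Real.exp ((s.re - a) * τ) := by
      rw [← Real.exp_add]; ring_nf
    rw [this, ← mul_assoc]
    exact mul_le_mul_of_nonneg_right h (Real.exp_pos _).le
  have hI : ‖∫ τ in Iic y, φ τ * cexp (s * τ)‖ ≤ C * (Real.exp ((s.re - a) * y) / (s.re - a)) := by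
    rw [← integral_Iic_exp_mul_le hc C y]
    refine norm_integral_le_of_norm_le ((integrableOn_exp_mul_Iic hc y).const_mul C) ?_
    exact ae_restrict_of_forall_mem measurableSet_Iic fun τ _ => hbound τ
  rw [logPrimitive, norm_mul, norm_neg, Complex.norm_exp]
  have hre : (-(s * (y : ℂ))).re = -(s.re * y) := by simp [Complex.mul_re]
  rw [hre]
  calc Real.exp (-(s.re * y)) * ‖∫ τ in Iic y, φ τ * cexp (s * τ)‖ * Real.exp (a * y)
      ≤ Real.exp (-(s.re * y)) * (C * (Real.exp ((s.re - a) * y) / (s.re - a))) * Real.exp (a * y) := by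
        gcongr
    _ = C / (s.re - a) * (Real.exp (-(s.re * y)) * Real.exp ((s.re - a) * y) * Real.exp (a * y)) := by ring
    _ = C / (s.re - a) := by
        rw [← Real.exp_add, ← Real.exp_add]
        have : -(s.re * y) + (s.re - a) * y + a * y = 0 := by ring
        rw [this, Real.exp_zero, mul_one]

/-- **Bound from above the abscissa** (needs `𝓛φ(s) = 0`): for `Re s < a`,
`‖R_s φ(y)‖ e^{ay} ≤ C_a / (a - Re s)`. [cite: Meyer2005, Thm. 5.11] -/
theorem norm_logPrimitive_mul_exp_le_of_gt (hφ : IsSuperExp φ) (h0 : laplace φ s = 0) {a : ℝ}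
    (ha : s.re < a) : ∃ C : ℝ, ∀ y : ℝ, ‖logPrimitive s φ y‖ * Real.exp (a * y) ≤ C := by
  obtain ⟨C, hC⟩ := hφ.norm_mul_exp_le a
  have hC0 : 0 ≤ C := le_trans (by positivity) (hC 0)
  have hc : s.re - a < 0 := by linarith
  refine ⟨C / (a - s.re), fun y => ?_⟩
  have hbound : ∀ τ : ℝ, ‖φ τ * cexp (s * τ)‖ ≤ C * Real.exp ((s.re - a) * τ) := by
    intro τ
    rw [norm_mul, Complex.norm_exp, Complex.mul_re, Complex.ofReal_re, Complex.ofReal_im, mul_zero,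
      sub_zero]
    have h := hC τ
    have : Real.exp (s.re * τ) = Real.exp (a * τ) * Real.exp ((s.re - a) * τ) := by
      rw [← Real.exp_add]; ring_nf
    rw [this, ← mul_assoc]
    exact mul_le_mul_of_nonneg_right h (Real.exp_pos _).le
  have hI : ‖∫ τ in Ioi y, φ τ * cexp (s * τ)‖ ≤ C * (-Real.exp ((s.re - a) * y) / (s.re - a)) := by
    rw [← integral_Ioi_exp_mul_le hc C y]
    refine norm_integral_le_of_norm_le ((integrableOn_exp_mul_Ioi hc y).const_mul C) ?_
    exact ae_restrict_of_forall_mem measurableSet_Ioi fun τ _ => hbound τ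
  rw [logPrimitive_eq_integral_Ioi s hφ h0 y, norm_mul, Complex.norm_exp]
  have hre : (-(s * (y : ℂ))).re = -(s.re * y) := by simp [Complex.mul_re]
  rw [hre]
  calc Real.exp (-(s.re * y)) * ‖∫ τ in Ioi y, φ τ * cexp (s * τ)‖ * Real.exp (a * y)
      ≤ Real.exp (-(s.re * y)) * (C * (-Real.exp ((s.re - a) * y) / (s.re - a))) * Real.exp (a * y) := by
        gcongr
    _ = C / (a - s.re) * (Real.exp (-(s.re * y)) * Real.exp ((s.re - a) * y) * Real.exp (a * y)) := by
        rw [neg_div, ← div_neg, neg_sub]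
        ring
    _ = C / (a - s.re) := by
        rw [← Real.exp_add, ← Real.exp_add]
        have : -(s.re * y) + (s.re - a) * y + a * y = 0 := by ring
        rw [this, Real.exp_zero, mul_one]

/-- **All exponential weights**: if `𝓛φ(s) = 0` then `‖R_s φ(y)‖ e^{αy}` is bounded for EVERY real
`α`. [cite: Meyer2005, Thm. 5.11] -/
theorem norm_logPrimitive_mul_exp_le (hφ : IsSuperExp φ) (h0 : laplace φ s = 0) (α : ℝ) :
    ∃ C : ℝ, ∀ y : ℝ, ‖logPrimitive s φ y‖ * Real.exp (α * y) ≤ C := by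
  -- above: weight `α + 1 ⊔ (Re s + 1)` controls `y ≥ 0`; below: weight `α ⊓ (Re s - 1)` controls `y ≤ 0`
  obtain ⟨C₁, h₁⟩ := norm_logPrimitive_mul_exp_le_of_gt s hφ h0 (a := max α (s.re + 1))
    (lt_of_lt_of_le (by linarith) (le_max_right _ _))
  obtain ⟨C₂, h₂⟩ := norm_logPrimitive_mul_exp_le_of_lt s hφ (a := min α (s.re - 1))
    (lt_of_le_of_lt (min_le_right _ _) (by linarith))
  refine ⟨max C₁ C₂, fun y => ?_⟩
  rcases le_total 0 y with hy | hy
  · refine le_trans ?_ (le_max_left _ _)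
    refine le_trans ?_ (h₁ y)
    gcongr
    exact le_max_left _ _
  · refine le_trans ?_ (le_max_right _ _)
    refine le_trans ?_ (h₂ y)
    have : min α (s.re - 1) * y ≥ α * y := by nlinarith [min_le_left α (s.re - 1)]
    gcongr

/-- Absorbing polynomial weights: `(1+|y|)^β ≤ e^{β|y|}`, split according to the sign of `y`.
[folklore] -/
theorem weight_le_exp (β : ℕ) (y : ℝ) : (1 + |y|) ^ β ≤ Real.exp (β * |y|) := by
  have h : 1 + |y| ≤ Real.exp |y| := by
    have := Real.add_one_le_exp |y|
    linarith
  calc (1 + |y|) ^ β ≤ (Real.exp |y|) ^ β := by gcongr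
    _ = Real.exp (β * |y|) := by rw [← Real.exp_nat_mul]

/-- **All weights, no derivatives**: `(1+|y|)^β ‖R_s φ(y)‖ e^{αy}` is bounded. [folklore] -/
theorem weight_norm_logPrimitive_mul_exp_le (hφ : IsSuperExp φ) (h0 : laplace φ s = 0) (β : ℕ) (α : ℝ) :
    ∃ C : ℝ, ∀ y : ℝ, (1 + |y|) ^ β * (‖logPrimitive s φ y‖ * Real.exp (α * y)) ≤ C := by
  obtain ⟨C₁, h₁⟩ := norm_logPrimitive_mul_exp_le s hφ h0 (α + β)
  obtain ⟨C₂, h₂⟩ := norm_logPrimitive_mul_exp_le s hφ h0 (α - β)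
  refine ⟨max C₁ C₂, fun y => ?_⟩
  have hw := weight_le_exp β y
  rcases le_total 0 y with hy | hy
  · rw [abs_of_nonneg hy] at hw
    refine le_trans ?_ ((h₁ y).trans (le_max_left _ _))
    calc (1 + |y|) ^ β * (‖logPrimitive s φ y‖ * Real.exp (α * y))
        ≤ Real.exp (β * y) * (‖logPrimitive s φ y‖ * Real.exp (α * y)) := by
          rw [abs_of_nonneg hy]; gcongr
      _ = ‖logPrimitive s φ y‖ * Real.exp ((α + β) * y) := by
          rw [add_mul, Real.exp_add]; ring
  · rw [abs_of_nonpos hy] at hw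
    refine le_trans ?_ ((h₂ y).trans (le_max_right _ _))
    calc (1 + |y|) ^ β * (‖logPrimitive s φ y‖ * Real.exp (α * y))
        ≤ Real.exp (β * (-y)) * (‖logPrimitive s φ y‖ * Real.exp (α * y)) := by
          rw [abs_of_nonpos hy]; gcongr
      _ = ‖logPrimitive s φ y‖ * Real.exp ((α - β) * y) := by
          rw [sub_mul, Real.exp_sub, mul_neg, Real.exp_neg]; ring

/-- The iterated derivatives of `R_s φ`: `(R_s φ)⁽ⁿ⁺¹⁾ = -s (R_s φ)⁽ⁿ⁾ - φ⁽ⁿ⁾`. [folklore] -/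
theorem iteratedDeriv_succ_logPrimitive (hφ : IsSuperExp φ) (n : ℕ) (y : ℝ) :
    iteratedDeriv (n + 1) (logPrimitive s φ) y =
      -s * iteratedDeriv n (logPrimitive s φ) y - iteratedDeriv n φ y := by
  rw [iteratedDeriv_succ', deriv_logPrimitive s hφ]
  have hR : ContDiffAt ℝ n (fun y => -s * logPrimitive s φ y) y :=
    (contDiff_const.mul ((contDiff_logPrimitive s hφ).of_le (mod_cast le_top))).contDiffAt
  have hφn : ContDiffAt ℝ n φ y := (hφ.contDiff.of_le (mod_cast le_top)).contDiffAt
  rw [show (fun y => -s * logPrimitive s φ y - φ y) = (fun y => -s * logPrimitive s φ y) - φ from rfl,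
    iteratedDeriv_sub hR hφn,
    iteratedDeriv_const_mul (-s) (((contDiff_logPrimitive s hφ).of_le (mod_cast le_top)).contDiffAt)]

/-- **`R_s` preserves super-exponential decay** when `𝓛φ(s) = 0`. [cite: Meyer2005, Thm. 5.11] -/
theorem isSuperExp_logPrimitive (hφ : IsSuperExp φ) (h0 : laplace φ s = 0) :
    IsSuperExp (logPrimitive s φ) := by
  refine ⟨contDiff_logPrimitive s hφ, fun n => ?_⟩
  induction n with
  | zero =>
      intro β α
      obtain ⟨C, hC⟩ := weight_norm_logPrimitive_mul_exp_le s hφ h0 β α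
      exact ⟨C, fun y => by rw [iteratedDeriv_zero]; exact hC y⟩
  | succ n ih =>
      intro β α
      obtain ⟨C₁, h₁⟩ := ih β α
      obtain ⟨C₂, h₂⟩ := hφ.decay n β α
      refine ⟨‖s‖ * C₁ + C₂, fun y => ?_⟩
      rw [iteratedDeriv_succ_logPrimitive s hφ n y]
      have hw : 0 ≤ (1 + |y|) ^ β := by positivity
      have he : 0 ≤ Real.exp (α * y) := (Real.exp_pos _).le
      calc (1 + |y|) ^ β * (‖-s * iteratedDeriv n (logPrimitive s φ) y - iteratedDeriv n φ y‖ * Real.exp (α * y))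
          ≤ (1 + |y|) ^ β * ((‖s‖ * ‖iteratedDeriv n (logPrimitive s φ) y‖ + ‖iteratedDeriv n φ y‖) *
              Real.exp (α * y)) := by
            gcongr
            refine (norm_sub_le _ _).trans ?_
            rw [norm_mul, norm_neg]
        _ = ‖s‖ * ((1 + |y|) ^ β * (‖iteratedDeriv n (logPrimitive s φ) y‖ * Real.exp (α * y))) +
              (1 + |y|) ^ β * (‖iteratedDeriv n φ y‖ * Real.exp (α * y)) := by ring
        _ ≤ ‖s‖ * C₁ + C₂ := by gcongr <;> [exact h₁ y; exact h₂ y]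

/-- **`R_s` divides the Laplace transform by `z - s`**: `(z - s) 𝓛(R_s φ)(z) = 𝓛φ(z)` for all `z`,
when `𝓛φ(s) = 0`. [cite: Meyer2005, Thm. 5.11] -/
theorem laplace_logPrimitive (hφ : IsSuperExp φ) (h0 : laplace φ s = 0) (z : ℂ) :
    (z - s) * laplace (logPrimitive s φ) z = laplace φ z := by
  have hR := isSuperExp_logPrimitive s hφ h0
  -- `φ = -(R_s φ)' - s R_s φ`
  have hφeq : φ = fun y => -_root_.deriv (logPrimitive s φ) y - s * logPrimitive s φ y := by
    funext y
    rw [deriv_logPrimitive s hφ]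
    ring
  have hlin : laplace φ z = -laplace (_root_.deriv (logPrimitive s φ)) z - s * laplace (logPrimitive s φ) z := by
    conv_lhs => rw [hφeq]
    rw [laplace, laplace, laplace, ← integral_neg, ← integral_const_mul, ← integral_sub]
    · refine integral_congr_ae (Eventually.of_forall fun y => ?_)
      ring
    · exact (hR.deriv.integrable_mul_cexp z).neg
    · exact (hR.integrable_mul_cexp z).const_mul s
  rw [hlin, laplace_deriv hR z]
  ring

end LogPrimitive

/-! ### Bridge to `Literature.Analysis.Distribution.SuperExpDecay` -/

section Bridge

open Literature.Analysis.Distribution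

/-- **`IsSuperExp` is smoothness plus the tree's `SuperExpDecay`** (`‖φ⁽ʲ⁾(s)‖ ≤ C e^{cs}` for all
`j` and all real `c`): the polynomial weight `(1+|y|)^β` of `IsSuperExp.decay` is absorbed by
`e^{β|y|}` (`weight_le_exp`). [folklore] -/
theorem isSuperExp_iff_superExpDecay (φ : ℝ → ℂ) : IsSuperExp φ ↔ ContDiff ℝ ∞ φ ∧ SuperExpDecay φ := by
  constructor
  · intro h
    refine ⟨h.contDiff, fun j c => ?_⟩
    obtain ⟨C, hC⟩ := h.decay j 0 (-c)
    refine ⟨C, fun y => ?_⟩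
    have h1 := hC y
    rw [pow_zero, one_mul] at h1
    -- `‖φ⁽ʲ⁾ y‖ e^{-cy} ≤ C`
    have hpos : 0 < Real.exp (-c * y) := Real.exp_pos _
    calc ‖iteratedDeriv j φ y‖ = ‖iteratedDeriv j φ y‖ * Real.exp (-c * y) * Real.exp (c * y) := by
          rw [mul_assoc, ← Real.exp_add, show -c * y + c * y = 0 by ring, Real.exp_zero, mul_one]
      _ ≤ C * Real.exp (c * y) := by gcongr
  · rintro ⟨hs, hd⟩
    refine ⟨hs, fun n β α => ?_⟩
    obtain ⟨C₁, h₁⟩ := hd n (-(α + β))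
    obtain ⟨C₂, h₂⟩ := hd n (-(α - β))
    refine ⟨max C₁ C₂, fun y => ?_⟩
    have hw := weight_le_exp β y
    rcases le_total 0 y with hy | hy
    · rw [abs_of_nonneg hy] at hw ⊢
      refine le_trans ?_ (le_max_left _ _)
      calc (1 + y) ^ β * (‖iteratedDeriv n φ y‖ * Real.exp (α * y))
          ≤ Real.exp (β * y) * (C₁ * Real.exp (-(α + β) * y) * Real.exp (α * y)) := by
            gcongr
            exact h₁ y
        _ = C₁ := by
            have : Real.exp (β * y) * Real.exp (-(α + β) * y) * Real.exp (α * y) = 1 := by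
              rw [← Real.exp_add, ← Real.exp_add, show β * y + -(α + β) * y + α * y = 0 by ring, Real.exp_zero]
            linear_combination C₁ * this
    · rw [abs_of_nonpos hy] at hw ⊢
      refine le_trans ?_ (le_max_right _ _)
      calc (1 + -y) ^ β * (‖iteratedDeriv n φ y‖ * Real.exp (α * y))
          ≤ Real.exp (β * -y) * (C₂ * Real.exp (-(α - β) * y) * Real.exp (α * y)) := by
            gcongr
            exact h₂ y
        _ = C₂ := by
            have : Real.exp (β * -y) * Real.exp (-(α - β) * y) * Real.exp (α * y) = 1 := by
              rw [← Real.exp_add, ← Real.exp_add, show β * -y + -(α - β) * y + α * y = 0 by ring, Real.exp_zero]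
            linear_combination C₂ * this

/-- From the tree's format: a smooth function with `SuperExpDecay` is `IsSuperExp`. [folklore] -/
theorem IsSuperExp.of_superExpDecay {φ : ℝ → ℂ} (hs : ContDiff ℝ ∞ φ) (hd : SuperExpDecay φ) : IsSuperExp φ :=
  (isSuperExp_iff_superExpDecay φ).mpr ⟨hs, hd⟩

/-- To the tree's format. [folklore] -/
theorem IsSuperExp.superExpDecay {φ : ℝ → ℂ} (h : IsSuperExp φ) : SuperExpDecay φ :=
  ((isSuperExp_iff_superExpDecay φ).mp h).2

end Bridge

end Literature.NumberTheory.Automorphic.Meyer
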